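import Summits.QuantumFields.YangMills.Theorems.UnitScaleTiltProp7IterLinearisationFlat
import HarnessLib

/-!
# Route `UnitScaleTilt`, crux K1 «MinimiserStabilityRegPr» (stmt-QuantumFields-19200), stubs `stub_prop8` (V2) ∕ `stub_prop7From14` (V3) — sub-lemma D1c k-fold, FLAT, STRUCTURE:
# **THE TRUE k-FOLD LINEARISED (0.4)-CONSTRAINT IS PRINT'S STRAIGHT k-FOLD AVERAGE `L^k·Q_k` MINUS A COARSE PURE GAUGE, AND MAPS FINE PURE GAUGES TO
# COARSE PURE GAUGES BY RESTRICTION TO THE CENTRES** (`exists_iterLin_eq_bondAvgIter_sub_grad`, `iterLin_grad`)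

Cell `ym3-torus` ∕ fleet seat `ym-ust-19200-p2` g4.  The PORT question of the V2∕V3 censuses («print's Q_k of [Balaban1984PropagatorsI] (1.18) vs the family's
(0.4)»), answered at the linearised flat level for all `k`: with `Q^{(k)} = Q₁∘⋯∘Q₁` the k-fold composite of `linAvg` (= the derivative of the k-fold descent at
the flat configuration, `…Prop7IterLinearisationFlat`), (i) `Q^{(k)}(dφ) = d(φ∘emb^k)` — a fine pure gauge is mapped to the coarse pure gauge obtained by
RESTRICTING the gauge function to the k-fold block centres ([Balaban1985Averaging] (11), linearised and iterated; one step = p482040's `linAvg_grad`); (ii) there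
is a coarse site function `Λ_k(Y)` with `Q^{(k)}Y = L^k·(Q_kY) − dΛ_k(Y)`, `Q_k = LatticeFieldCalculus.bondAvgIter k` (print's (1.18)) — the two constraint
operators differ by a COARSE PURE GAUGE (one step = p483315's `linAvg_eq_bondAvg_sub_grad_combMean`, iterated through `bondAvg_grad`: `Q∂ = ∂Q′`).  So every
coarse-gauge-invariant use of the constraint may be read through print's `Q_k` (p1 g3's tent right inverse, constant 3) or through `Q^{(k)}` (this seat's
`exists_rightInverse_iterLin`, constant 1).  Both families (`Q^{(i)}`, the restriction `E_i φ = φ∘emb^i`) are characterised by their recursions, not defined.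
Sorry-free, no definition. [folklore] ∕ cited.  References: T. Bałaban, CMP 95 (1984) 17–40 [Balaban1984PropagatorsI] ((1.13), (1.18), (1.20) pp.19–20);
CMP 98 (1985) 17–51 [Balaban1985Averaging] ((11) p.18, (124)–(125) p.36); CMP 102 (1985) 277–309 [Balaban1985Variational] ((156) p.302).
-/

noncomputable section

open scoped BigOperators Matrix.Norms.L2Operator Matrix
open Function

namespace Summit.QuantumFields.YangMills.Theorems.Prop7AvgLinearisation

open Literature.MathematicalPhysics.QuantumFieldTheory.Balaban1983to89
open T4Continuum AveragingRT BlockAveraging BlockAveragingEMLLinearised LatticeFieldCalculus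
open Summit.QuantumFields.YangMills.Theorems.Prop7LinAvgOnto (linAvg_add)

variable {P : Params} {n : Type*} [Fintype n] [DecidableEq n] [Nonempty n]

/-! ## §1 Pure gauges: `Q^{(k)}(dφ) = d(φ∘emb^k)` -/

omit [Fintype n] [DecidableEq n] [Nonempty n] in
/-- **THE LINEARISED k-FOLD CONSTRAINT ON A FINE PURE GAUGE** is the coarse pure gauge of the gauge function restricted to the k-fold block centres:
with `E_i` any family with `E_0 φ = φ`, `E_{i+1} φ = (E_i φ)∘emb` and `Q^{(i)}` the composite of `linAvg`, `Q^{(k)}(dφ)(c) = (E_kφ)(c₊) − (E_kφ)(c₋)`.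
[cite: Balaban1985Averaging, (11) p.18] -/
theorem iterLin_grad
    (Q : (i : ℕ) → (PBond P 0 → Matrix n n ℂ) → PBond P i → Matrix n n ℂ)
    (hQ0 : ∀ Y, Q 0 Y = Y) (hQs : ∀ (i : ℕ) (Y : PBond P 0 → Matrix n n ℂ) (c : PBond P (i + 1)), Q (i + 1) Y c = linAvg (Q i Y) c)
    (E : (i : ℕ) → (Site P 0 → Matrix n n ℂ) → Site P i → Matrix n n ℂ)
    (hE0 : ∀ φ, E 0 φ = φ) (hEs : ∀ (i : ℕ) (φ : Site P 0 → Matrix n n ℂ) (y : Site P (i + 1)), E (i + 1) φ y = E i φ (emb y))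
    (φ : Site P 0 → Matrix n n ℂ) :
    ∀ (k : ℕ) (c : PBond P k), Q k (fun b => φ b.tgt - φ b.src) c = E k φ c.tgt - E k φ c.src := by
  intro k
  induction k with
  | zero => intro c; rw [hQ0, hE0]
  | succ k ih =>
    intro c
    rw [hQs, show Q k (fun b => φ b.tgt - φ b.src) = fun b : PBond P k => E k φ b.tgt - E k φ b.src from funext ih, linAvg_grad, hEs, hEs]

/-! ## §2 `Q^{(k)} = L^k·Q_k − dΛ_k` -/

omit [Fintype n] [DecidableEq n] [Nonempty n] in
/-- The linearised one-step average commutes with natural-number scalars (additivity, `linAvg_add`). [cite: Balaban1985Averaging, (124)-(125) p.36] -/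
theorem linAvg_nsmul {j : ℕ} (m : ℕ) (Y : PBond P j → Matrix n n ℂ) (c : PBond P (j + 1)) :
    linAvg (fun b => m • Y b) c = m • linAvg Y c := by
  induction m with
  | zero =>
    simp only [zero_smul]
    have h := linAvg_sub Y Y c
    simp only [sub_self] at h
    exact h
  | succ m ih =>
    simp only [add_smul, one_smul]
    rw [linAvg_add, ih]

omit [Fintype n] [DecidableEq n] [Nonempty n] in
/-- **THE TRUE LINEARISED k-FOLD (0.4)-CONSTRAINT IS PRINT'S `L^k·Q_k` MINUS A COARSE PURE GAUGE**: for every `k ≤ m + K` and every fine bond field `Y` there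
is a coarse site function `Λ` with `Q^{(k)}Y(c) = L^k·(Q_kY)(c) − (Λ(c₊) − Λ(c₋))` for all level-`k` bonds `c`, `Q_k = bondAvgIter k`.
[cite: Balaban1984PropagatorsI, (1.18)-(1.20) p.20; Balaban1985Averaging, (124)-(125) p.36] -/
theorem exists_iterLin_eq_bondAvgIter_sub_grad
    (Q : (i : ℕ) → (PBond P 0 → Matrix n n ℂ) → PBond P i → Matrix n n ℂ)
    (hQ0 : ∀ Y, Q 0 Y = Y) (hQs : ∀ (i : ℕ) (Y : PBond P 0 → Matrix n n ℂ) (c : PBond P (i + 1)), Q (i + 1) Y c = linAvg (Q i Y) c)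
    (Y : PBond P 0 → Matrix n n ℂ) :
    ∀ k : ℕ, k ≤ P.m + P.K → ∃ Λ : Site P k → Matrix n n ℂ,
      ∀ c : PBond P k, Q k Y c = (P.L ^ k : ℕ) • bondAvgIter k Y c - (Λ c.tgt - Λ c.src) := by
  intro k
  induction k with
  | zero =>
    intro _
    refine ⟨fun _ => 0, fun c => ?_⟩
    rw [hQ0, pow_zero, one_smul, sub_self, sub_zero]
    rfl
  | succ k ih =>
    intro hk
    obtain ⟨Λ, hΛ⟩ := ih (Nat.le_of_succ_le hk)
    -- `Λ_{k+1} = L^k·λ̄_{Q_kY} + Λ_k∘emb`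
    refine ⟨fun y => (P.L ^ k : ℕ) • combMean (bondAvgIter k Y) y + Λ (emb y), fun c => ?_⟩
    have hfun : Q k Y = fun b : PBond P k => (P.L ^ k : ℕ) • bondAvgIter k Y b - (Λ b.tgt - Λ b.src) := funext hΛ
    rw [hQs, hfun, linAvg_sub (fun b : PBond P k => (P.L ^ k : ℕ) • bondAvgIter k Y b) (fun b => Λ b.tgt - Λ b.src) c,
      linAvg_nsmul, linAvg_grad, linAvg_eq_bondAvg_sub_grad_combMean]
    have hiter : bondAvgIter (k + 1) Y = bondAvg (bondAvgIter k Y) := rfl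
    rw [hiter, pow_succ, mul_smul, Nat.cast_smul_eq_nsmul ℂ, smul_sub, smul_sub]
    simp only [sub_eq_add_neg, neg_add, neg_neg]
    abel

end Summit.QuantumFields.YangMills.Theorems.Prop7AvgLinearisation

end
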